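import Literature.NumberTheory.GaloisRepresentations.WeilDeligneOfGalois
import Literature.NumberTheory.GaloisRepresentations.WeilGroupFrobeniusPowers
import Literature.NumberTheory.GaloisRepresentations.GaloisRepUnramifiedProofs
import Literature.NumberTheory.Automorphic.AdicCompletionLocalField
import Literature.LinearAlgebra.Matrix.NilpotentExpInjective
import HarnessLib

/-!
# The Weil–Deligne representation of an UNRAMIFIED `ℓ`-adic representation: `N = 0`, `ρ_WD = ρ`

Topic `Literature/NumberTheory/GaloisRepresentations`, proof file (theorems only, no definition,
no named fact) next to `WeilDeligneOfGalois` (the Grothendieck–Deligne dictionary as the relation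
`IsWeilDeligneOfLadic ρW r`, the transport `WeilDeligneRep.IsTransportAlong ι r r'` and the
Frobenius-semisimple class `WeilDeligneRep.HasFrobSemisimpleClass r c`) and to
`GaloisRepUnramifiedProofs` (`GaloisRep.isUnramifiedAt_iff_toLocal_holds`).

The unramified case of the dictionary (Tate 1979, (4.1.3)–(4.2.1); Deligne 1973, §8.4.2): if
`ρW : W_F →* GL_n(E)` is trivial on the inertia group and `r = (ρ_WD, N)` is attached to `ρW`
by the recipe (`ρW(u) = exp(t(u) N)` on an open `U ≤ I_F` with `t` non-trivial on `U`,
`ρ_WD(Φ^m u) = ρW(Φ^m u) exp(-t(u) N)`), then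

* `IsWeilDeligneOfLadic.N_eq_zero_of_forall_inertia` — `N = 0` (`exp(t(u₀) N) = ρW(u₀) = 1`
  with `t(u₀) ≠ 0`, and `exp` is injective on nilpotent matrices,
  `Literature.LinearAlgebra.Matrix.eq_of_exp_eq_exp`);
* `IsWeilDeligneOfLadic.toMatrix'_ρ_eq_of_forall_inertia` — `ρ_WD(w) = ρW(w)` for every
  `w ∈ W_F` (`W_F = Φ^ℤ · I_F`, `WeilGroup.zpow_deg_mul_mem_inertia`), in particular
  `IsWeilDeligneOfLadic.isUnramifiedRep_of_forall_inertia` — `ρ_WD` is unramified;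
* the two properties `N = 0`, "unramified" pass along `IsTransportAlong ι`
  (`WeilDeligneRep.IsTransportAlong.N_eq_zero`, `….isUnramifiedRep`) and to the
  Frobenius-semisimplification (`WeilDeligneRep.HasFrobSemisimpleClass.exists_of_isUnramifiedRep`:
  the class `c` is represented by a Frobenius-semisimple `r'` with `N = 0`, `ρ'` unramified —
  same `N` and same restriction to inertia, `IsFrobSemisimplificationOf`);
* `FramedGaloisRep.toWeilGroupHom_toLocal_eq_one_of_isUnramifiedAt` — for a framed
  representation `r` of `Γ_K` (`K` a number field) unramified at the finite place `v`, the
  restriction `(r|_{Γ_{K_v}})|_{W_{K_v}}` is trivial on `I_{K_v}` (the discharged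
  `GaloisRep.isUnramifiedAt_iff_toLocal_holds` plus `WeilGroup.mem_inertia_iff`);
* `FramedGaloisRep.exists_frobSemisimple_unramified_of_isUnramifiedAt` — assembling: for `r`
  unramified at `v`, every Weil–Deligne representation `rv` attached to `r|_{Γ_{K_v}}` by the
  recipe, every transport `rℂ = ι(rv)` and every class `c` of its Frobenius-semisimplification,
  `c = ⟦r'⟧` with `r'.N = 0` and `r'.ρ` unramified.  This is the Galois half of "at a place where
  `r` is unramified, local–global compatibility `WD(r|_{Γ_{K_v}})^{F-ss} ≅ rec_v(π_v)` pins
  `rec_v(π_v)` to an unramified parameter" (used by `HilbertModularLocalGlobalProofs`).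

Discharged facts used: `IsFrobPow.mul_holds`, `IsFrobPow.unique_holds` (inside
`WeilGroup.zpow_deg_mul_mem_inertia`), `GaloisRep.isUnramifiedAt_iff_toLocal_holds`.

## References

* J. Tate, *Number theoretic background*, Corvallis 1979, (4.1.3), (4.2.1). [TateCorvallis1979]
* P. Deligne, *Les constantes des équations fonctionnelles des fonctions `L`*, Antwerp II,
  LNM 349 (1973), §8.4.2. [DeligneAntwerpII1973]
* J.-P. Serre, *Abelian `ℓ`-adic representations and elliptic curves* (1968), Ch. I §2.1.
  [SerreAbelianLadic1968]
-/

noncomputable section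

open scoped MatrixGroups NumberField
open IsDedekindDomain

namespace Literature.NumberTheory.GaloisRepresentations

variable {F : Type*} [Field F] [ValuativeRel F] [TopologicalSpace F] [IsNonarchimedeanLocalField F]

/-! ### Local: the recipe at a `ρW` trivial on inertia -/

section Ladic

variable {E : Type*} [Field E] [CharZero E] {n : ℕ}

/-- `exp (c • M) = 1` with `M` nilpotent and `c ≠ 0` forces `M = 0` (injectivity of `exp` on
nilpotent matrices, `Literature.LinearAlgebra.Matrix.eq_of_exp_eq_exp`). [folklore] -/
theorem Matrix.eq_zero_of_exp_smul_eq_one {M : Matrix (Fin n) (Fin n) E} (hM : IsNilpotent M)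
    {c : E} (hc : c ≠ 0) (h : IsNilpotent.exp (c • M) = 1) : M = 0 := by
  have h0 : c • M = 0 := by
    apply Literature.LinearAlgebra.Matrix.eq_of_exp_eq_exp (hM.smul c) IsNilpotent.zero
    rw [h, IsNilpotent.exp_zero]
  exact (smul_eq_zero.mp h0).resolve_left hc

variable {ρW : WeilGroup F →* GL (Fin n) E} {r : WeilDeligneRep F E (Fin n → E)}

/-- **Unramified `ρW` has `N = 0`.** If `r = (ρ_WD, N)` is attached to `ρW` by the
Grothendieck–Deligne recipe and `ρW` is trivial on the inertia group, then `N = 0`: at the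
element `u₀ ∈ U` with `t(u₀) ≠ 1` the recipe reads `exp(t(u₀) N) = ρW(u₀) = 1`.
[cite: TateCorvallis1979, (4.2.1)] [cite: DeligneAntwerpII1973, §8.4.2] -/
theorem IsWeilDeligneOfLadic.N_eq_zero_of_forall_inertia (h : IsWeilDeligneOfLadic ρW r)
    (hρ : ∀ u ∈ WeilGroup.inertia F, ρW u = 1) : r.N = 0 := by
  obtain ⟨t, U, Φ, hU, -, -, ⟨u₀, hu₀U, ht₀⟩, h2, -⟩ := h
  have hNnil : IsNilpotent (LinearMap.toMatrix' r.N) :=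
    r.isNilpotent_N.map LinearMap.toMatrixAlgEquiv'
  have ht₀a : (t u₀).toAdd ≠ 0 := fun h => ht₀ (by rw [← ofAdd_toAdd (t u₀), h, ofAdd_zero])
  have hexp := h2 u₀ hu₀U
  rw [hρ (u₀ : WeilGroup F) (hU hu₀U), Units.val_one] at hexp
  have hmat : LinearMap.toMatrix' r.N = 0 :=
    Matrix.eq_zero_of_exp_smul_eq_one hNnil ht₀a hexp.symm
  exact (LinearEquiv.map_eq_zero_iff LinearMap.toMatrix').mp hmat

/-- **Unramified `ρW`: `ρ_WD = ρW`.** With `N = 0` the recipe returns `ρW` itself: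
`[ρ_WD(w)] = ρW(w)` for every `w ∈ W_F` (write `w = Φ^{-deg w} · (Φ^{deg w} w)` with
`Φ^{deg w} w ∈ I_F`, `WeilGroup.zpow_deg_mul_mem_inertia`). [cite: TateCorvallis1979, (4.1.3)–(4.2.1)] -/
theorem IsWeilDeligneOfLadic.toMatrix'_ρ_eq_of_forall_inertia (h : IsWeilDeligneOfLadic ρW r)
    (hρ : ∀ u ∈ WeilGroup.inertia F, ρW u = 1) (w : WeilGroup F) :
    LinearMap.toMatrix' (r.ρ w) = ((ρW w : GL (Fin n) E) : Matrix (Fin n) (Fin n) E) := by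
  have hN : r.N = 0 := h.N_eq_zero_of_forall_inertia hρ
  obtain ⟨t, U, Φ, -, -, hΦ, -, -, h3⟩ := h
  have hmem : Φ ^ (WeilGroup.deg w) * w ∈ WeilGroup.inertia F :=
    WeilGroup.zpow_deg_mul_mem_inertia hΦ w
  have key := h3 (-WeilGroup.deg w) ⟨Φ ^ (WeilGroup.deg w) * w, hmem⟩
  have hw : Φ ^ (-WeilGroup.deg w) * (Φ ^ (WeilGroup.deg w) * w) = w := by
    rw [← mul_assoc, zpow_neg, inv_mul_cancel, one_mul]
  simp only [hw, hN, map_zero, smul_zero, neg_zero, IsNilpotent.exp_zero, mul_one] at key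
  exact key

/-- **Unramified `ρW`: `ρ_WD` is unramified** (trivial on `I_F`). [cite: TateCorvallis1979, (4.1.3)–(4.2.1)] -/
theorem IsWeilDeligneOfLadic.isUnramifiedRep_of_forall_inertia (h : IsWeilDeligneOfLadic ρW r)
    (hρ : ∀ u ∈ WeilGroup.inertia F, ρW u = 1) : WeilGroup.IsUnramifiedRep r.ρ := by
  intro u hu
  have key := h.toMatrix'_ρ_eq_of_forall_inertia hρ u
  rw [hρ u hu, Units.val_one, ← LinearMap.toMatrix'_one] at key
  exact LinearMap.toMatrix'.injective key

end Ladic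

/-! ### Transport along `ι` and Frobenius-semisimplification preserve "unramified, `N = 0`" -/

namespace WeilDeligneRep

variable {E : Type*} [Field E] [CharZero E] {C : Type*} [Field C] [CharZero C] {n : ℕ}
  {ι : E →+* C} {r : WeilDeligneRep F E (Fin n → E)} {r' : WeilDeligneRep F C (Fin n → C)}

/-- Transport along `ι` preserves `N = 0`. [cite: DeligneAntwerpII1973, §8.4.3] -/
theorem IsTransportAlong.N_eq_zero (hT : r.IsTransportAlong ι r') (hN : r.N = 0) : r'.N = 0 := by
  have h := hT.2
  rw [hN, map_zero, Matrix.map_zero _ (map_zero ι)] at h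
  exact (LinearEquiv.map_eq_zero_iff LinearMap.toMatrix').mp h

/-- Transport along `ι` preserves unramifiedness. [cite: DeligneAntwerpII1973, §8.4.3] -/
theorem IsTransportAlong.isUnramifiedRep (hT : r.IsTransportAlong ι r')
    (hr : WeilGroup.IsUnramifiedRep r.ρ) : WeilGroup.IsUnramifiedRep r'.ρ := by
  intro u hu
  have h := hT.1 u
  rw [hr u hu, LinearMap.toMatrix'_one, Matrix.map_one _ (map_zero ι) (map_one ι),
    ← LinearMap.toMatrix'_one] at h
  exact LinearMap.toMatrix'.injective h

/-- If `r` has `N = 0` and unramified `ρ`, every class of its Frobenius-semisimplification is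
represented by a Frobenius-semisimple `r'` with `N = 0` and unramified `ρ'` (a
Frobenius-semisimplification has the same `N` and the same restriction to inertia).
[cite: DeligneAntwerpII1973, §8.6] [cite: TateCorvallis1979, (4.1.3)] -/
theorem HasFrobSemisimpleClass.exists_of_isUnramifiedRep {r : WeilDeligneRep F ℂ (Fin n → ℂ)}
    {c : Quotient (Literature.NumberTheory.Automorphic.frobSemisimpleWDSetoid F n)}
    (h : r.HasFrobSemisimpleClass c) (hN : r.N = 0) (hr : WeilGroup.IsUnramifiedRep r.ρ) :
    ∃ (r' : WeilDeligneRep F ℂ (Fin n → ℂ)) (hr' : r'.IsFrobSemisimple),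
      Quotient.mk (Literature.NumberTheory.Automorphic.frobSemisimpleWDSetoid F n) ⟨r', hr'⟩ = c ∧
        r'.N = 0 ∧ WeilGroup.IsUnramifiedRep r'.ρ := by
  obtain ⟨r', hss, hc⟩ := h
  exact ⟨r', hss.isFrobSemisimple, hc, hss.1.trans hN, fun u hu => (hss.2.1 u hu).trans (hr u hu)⟩

end WeilDeligneRep

/-! ### Global: a representation unramified at `v` is trivial on `I_{K_v}` -/

section Global

variable {K : Type} [Field K] [NumberField K] {A : Type*} [CommRing A] [TopologicalSpace A]
  [IsTopologicalRing A] {n : ℕ}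

omit [IsTopologicalRing A] in
/-- For a framed representation, `ρ.toRepresentation g = 1 ↔ ρ g = 1` (the standard
representation of `GL (Fin n) A` is faithful). [folklore] -/
theorem FramedRep.toRepresentation_apply_eq_one_iff {G : Type*} [Group G] [TopologicalSpace G]
    (ρ : FramedRep G A n) (g : G) : ρ.toRepresentation g = 1 ↔ ρ g = 1 := by
  constructor
  · intro h
    have h1 : Matrix.toLin' ((ρ g : GL (Fin n) A) : Matrix (Fin n) (Fin n) A) =
        Matrix.toLin' 1 := by
      rw [Matrix.toLin'_one]
      refine LinearMap.ext fun v => ?_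
      simpa using congr($h v)
    exact Units.ext (Matrix.toLin'.injective h1)
  · intro h
    refine LinearMap.ext fun v => ?_
    simp [h]

/-- **A representation unramified at `v` kills the local inertia group** (framed form of the
discharged `GaloisRep.isUnramifiedAt_iff_toLocal_holds`, direction `→`): for `r : Γ_K →ₜ* GL_n(A)`
unramified at the finite place `v` and `σ ∈ I_{K_v} ≤ Γ_{K_v}`, `r|_{Γ_{K_v}}(σ) = 1`.
[cite: SerreAbelianLadic1968, Ch. I §2.1] -/
theorem FramedGaloisRep.toLocal_eq_one_of_mem_absInertia (r : FramedGaloisRep K A n)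
    {v : HeightOneSpectrum (𝓞 K)} (hr : r.IsUnramifiedAt v)
    {σ : Field.absoluteGaloisGroup (v.adicCompletion K)}
    (hσ : σ ∈ absInertia (v.adicCompletion K)) : r.toLocal v σ = 1 := by
  have h1 : r.toGaloisRep.IsUnramifiedAt v := (r.isUnramifiedAt_toGaloisRep_iff v).mpr hr
  have h2 := (GaloisRep.isUnramifiedAt_iff_toLocal_holds v r.toGaloisRep).mp h1 σ hσ
  have h3 : FramedRep.toRepresentation r (absGaloisRestrict K (v.adicCompletion K) σ) = 1 := h2
  rw [FramedRep.toRepresentation_apply_eq_one_iff] at h3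
  rw [FramedGaloisRep.toLocal_apply]
  exact h3

/-- **… hence its restriction to the Weil group is trivial on `I_{K_v} ∩ W_{K_v}`**
(`WeilGroup.mem_inertia_iff`). [cite: TateCorvallis1979, (1.4.1) and (4.2.1)] -/
theorem FramedGaloisRep.toWeilGroupHom_toLocal_eq_one_of_isUnramifiedAt (r : FramedGaloisRep K A n)
    {v : HeightOneSpectrum (𝓞 K)} (hr : r.IsUnramifiedAt v) :
    ∀ u ∈ WeilGroup.inertia (v.adicCompletion K), (r.toLocal v).toWeilGroupHom u = 1 := by
  intro u hu
  rw [FramedRep.toWeilGroupHom_apply]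
  exact r.toLocal_eq_one_of_mem_absInertia hr (WeilGroup.mem_inertia_iff.mp hu)

/-- **At a place where `r` is unramified, `WD(r|_{Γ_{K_v}})^{F-ss}` is an unramified parameter.**
For `r : Γ_K →ₜ* GL_n(E)` unramified at the finite place `v`, every Weil–Deligne representation
`rv` attached to `r|_{W_{K_v}}` by the Grothendieck–Deligne recipe, every transport `rℂ` of `rv`
along `ι : E →+* ℂ`, and every class `c` of the Frobenius-semisimplification of `rℂ`:
`c = ⟦r'⟧` for a Frobenius-semisimple `r'` with `r'.N = 0` and `r'.ρ` trivial on inertia.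
[cite: TateCorvallis1979, (4.1.3)–(4.2.1)] [cite: DeligneAntwerpII1973, §8.4.2 and §8.6] -/
theorem FramedGaloisRep.exists_frobSemisimple_unramified_of_isUnramifiedAt {E : Type*} [Field E]
    [CharZero E] [TopologicalSpace E] [IsTopologicalRing E] (r : FramedGaloisRep K E n)
    {v : HeightOneSpectrum (𝓞 K)} (hr : r.IsUnramifiedAt v) (ι : E →+* ℂ)
    {rv : WeilDeligneRep (v.adicCompletion K) E (Fin n → E)}
    {rℂ : WeilDeligneRep (v.adicCompletion K) ℂ (Fin n → ℂ)}
    {c : Quotient (Literature.NumberTheory.Automorphic.frobSemisimpleWDSetoid (v.adicCompletion K) n)}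
    (hWD : IsWeilDeligneOfLadic (r.toLocal v).toWeilGroupHom rv) (hT : rv.IsTransportAlong ι rℂ)
    (hc : rℂ.HasFrobSemisimpleClass c) :
    ∃ (r' : WeilDeligneRep (v.adicCompletion K) ℂ (Fin n → ℂ)) (hr' : r'.IsFrobSemisimple),
      Quotient.mk _ ⟨r', hr'⟩ = c ∧ r'.N = 0 ∧ WeilGroup.IsUnramifiedRep r'.ρ := by
  have hI := r.toWeilGroupHom_toLocal_eq_one_of_isUnramifiedAt hr
  exact hc.exists_of_isUnramifiedRep (hT.N_eq_zero (hWD.N_eq_zero_of_forall_inertia hI))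
    (hT.isUnramifiedRep (hWD.isUnramifiedRep_of_forall_inertia hI))

end Global

end Literature.NumberTheory.GaloisRepresentations

end
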